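import Mathlib
import Summits.RiemannHypothesis.RiemannHypothesis.Theorems.WeilFarFloorProfileRigidityRH
import Summits.RiemannHypothesis.RiemannHypothesis.Theorems.WeilFarFloorCoshProfileEnergy
import Summits.RiemannHypothesis.RiemannHypothesis.Theorems.WeilFarFloorCoshZeroSum
import Summits.RiemannHypothesis.RiemannHypothesis.Theorems.WeilFarFloorModulusClassRH
import HarnessLib

/-!
# Under RH near-extremal window functions are asymptotically collinear with `cosh(x/2)` (profile rigidity at the floor)

Helper file (`--supports stmt-RiemannHypothesis-0098`, lead-track anchor: Weil-positivity window ladder, format-C far bound),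
pure proofs.  Seat rh-explicit-weil-1 gen13 (memo `run/shared/lean/pub/rh-explicit/rh-explicit-weil-1/FORMAT-K3.md` §14.5); STRUCTURE of
the extremals (EXTREMALS/STRUCTURE.md): the deliverable «how the extremal test functions look» for the far-coercivity floor `λ_max(a)`.

THE RESULT (`integral_sq_sub_profile_le_of_nearExtremal_of_RH`).  Under RH there is `a₀` such that for every window `b ≥ a₀`, every real
Weil test `u` supported in `[−b, b]` whose energy at scales `≤ e^{−b}` is budgeted by `B₀` (`∫_{(0,e^{−b}]} ρ_∞(t) D_t(u) dt ≤ B₀`) and which is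
`D`-NEAR-EXTREMAL, `Q_b(u) ≥ (λ_max(b) − D)·∫u²`, satisfies

  **`∫ (u − ⟨u, C_b⟩ C_b/‖C_b‖²)² ≤ ((2I₀ + 2β + 1 + D)·∫u² + 2B₀)/(b + sinh b)`**,  `C_b = cosh(·/2)·1_{[−b,b]}`, `‖C_b‖² = b + sinh b`,

`2I₀ + 2β = 2∫₀^∞(e^{t/2} − 1)/(2 sinh t)dt + 2(2 + γ − log 4π) ≈ 2.36`: the component of a near-extremal ORTHOGONAL to the cosh profile carries only
`O(e^{−b})` of its energy.  Proof: profile rigidity (`WeilFarFloorProfileRigidityRH.integral_sq_sub_profile_le_of_RH`, slope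
`S = 2‖C_b‖² + 4I₀ − 8Ψ(e^{−b}) ≥ ‖C_b‖²`) with the cosh profile's archimedean budget `A = 2I₀` (`coshProfile_archEnergy_le`), the deficit
`κ = ceiling − λ_max(b) + D`, and `ceiling − λ_max(b) ≤ ceiling − R_c(b) ≤ 2I₀ + 2β + 1` eventually under RH from the cosh-test asymptotics
(`WeilFarFloorCoshZeroSum.eventually_abs_coshSum_div_sub_le_of_RH`).  Standard axioms only; RH enters as Mathlib's `RiemannHypothesis`.
-/

set_option linter.dupNamespace false
set_option autoImplicit false

noncomputable section

open MeasureTheory Set Filter Topology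
open scoped Real ArithmeticFunction.vonMangoldt

namespace Summit.RiemannHypothesis.RiemannHypothesis.Theorems.WeilFormatC

namespace FloorCoshSplit

open Literature.NumberTheory.LFunctions FloorCosh FloorEnvelope FloorCoshZeroSum

/-! ## §1 Near-extremals are collinear with the cosh profile -/

/-- **PROFILE RIGIDITY AT THE FLOOR (under RH).**  See the file header. -/
theorem integral_sq_sub_profile_le_of_nearExtremal_of_RH (hRH : RiemannHypothesis) :
    ∃ a₀ : ℝ, ∀ b : ℝ, a₀ ≤ b → ∀ (u : ℝ → ℝ) (D B₀ : ℝ), 0 ≤ D →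
      IsWeilTest (fun x ↦ (u x : ℂ)) → tsupport (fun x ↦ (u x : ℂ)) ⊆ Icc (-b) b →
      (∫ t in Ioc 0 (Real.exp (-b)), weilArchDensity t * ∫ x, (u (x + t) - u x) ^ 2) ≤ B₀ →
      (farCoercivityFloor b - D) * (∫ x, u x ^ 2) ≤ primeShiftForm b u →
      ∫ x, (u x - (∫ y, u y * (Icc (-b) b).indicator (fun z ↦ Real.cosh (z / 2)) y) / (b + Real.sinh b)
            * (Icc (-b) b).indicator (fun z ↦ Real.cosh (z / 2)) x) ^ 2
        ≤ ((2 * (∫ t in Ioi (0 : ℝ), (Real.exp (t / 2) - 1) / (2 * Real.sinh t)) + 2 * nicolasBeta + 1 + D) * (∫ x, u x ^ 2)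
            + 2 * B₀) / (b + Real.sinh b) := by
  classical
  set I := ∫ t in Ioi (0 : ℝ), (Real.exp (t / 2) - 1) / (2 * Real.sinh t) with hI
  have hI0 : 0 ≤ I := setIntegral_nonneg measurableSet_Ioi fun t ht ↦ weilKillingDensity_nonneg ht
  -- the cosh quotient under RH: `R_c(b) ≥ e^b + 2b − 2 − 2γ − β − 1` eventually
  have hev := eventually_abs_coshSum_div_sub_le_of_RH hRH one_pos
  obtain ⟨a₁, ha₁⟩ := Filter.eventually_atTop.1 hev
  refine ⟨max a₁ 16, fun b hb u D B₀ hD hu hus hB₀ hnear ↦ ?_⟩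
  have hb1 : a₁ ≤ b := le_trans (le_max_left _ _) hb
  have hb6 : 16 ≤ b := le_trans (le_max_right _ _) hb
  have hb0 : 0 < b := by linarith
  have hb4 : 4 ≤ b := by linarith
  -- sizes of the window
  set P := b + Real.sinh b with hP
  have hsinh : b / 2 + b ^ 2 / 4 ≤ Real.sinh b := by
    rw [Real.sinh_eq]
    have h1 := Real.quadratic_le_exp_of_nonneg (by linarith : (0 : ℝ) ≤ b)
    have h2 : Real.exp (-b) ≤ 1 := Real.exp_le_one_iff.2 (by linarith)
    linarith
  have hP0 : 0 < P := by rw [hP]; nlinarith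
  have hP0' : 0 < b + Real.sinh b := by rw [← hP]; exact hP0
  -- the cut `t₀ = e^{−b}` and the slope
  set t₀ := Real.exp (-b) with ht₀
  have ht₀0 : 0 < t₀ := Real.exp_pos _
  have ht₀1 : t₀ ≤ 1 := by rw [ht₀]; exact Real.exp_le_one_iff.2 (by linarith)
  have hΨ : weilArchTail t₀ ≤ b / 2 + 2 := by
    have h1 := weilArchTail_le_half_log ht₀0 ht₀1
    rw [ht₀, show (1 : ℝ) / Real.exp (-b) = Real.exp b by rw [Real.exp_neg]; field_simp, Real.log_exp] at h1
    linarith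
  have hS : P ≤ 2 * P + (1 + 1 / 1) * (2 * I) - 4 * (1 + 1) * weilArchTail t₀ := by
    norm_num; rw [hP]; nlinarith [hΨ, hI0, hsinh, mul_le_mul_of_nonneg_left hb6 (by linarith : (0:ℝ) ≤ b)]
  have hSpos : 0 < 2 * (b + Real.sinh b) + (1 + 1 / 1) * (2 * I) - 4 * (1 + 1) * weilArchTail t₀ := by
    rw [← hP]; linarith
  -- the cosh profile's archimedean budget `A = 2I`
  obtain ⟨hCint, hA⟩ := coshProfile_archEnergy_le hb4 ht₀0 ht₀1
  rw [← hI] at hA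
  -- the deficit: `ceiling − λ_max(b) + D`
  set K := 2 * I + (Real.log (4 * π) + Real.eulerMascheroniConstant) with hK
  set κ := 2 * (b + Real.sinh b) + (1 + 1 / 1) * (2 * I) - K - farCoercivityFloor b + D with hκ
  have hNu0 : 0 ≤ ∫ x, u x ^ 2 := integral_nonneg fun x ↦ sq_nonneg _
  have hB₀0 : 0 ≤ B₀ := le_trans (setIntegral_nonneg measurableSet_Ioc fun t ht ↦
    mul_nonneg (weilArchDensity_pos ht.1).le (integral_nonneg fun x ↦ sq_nonneg _)) hB₀
  have hnear' : (2 * (b + Real.sinh b) + (1 + 1 / 1) * (2 * I) - K - κ) * (∫ x, u x ^ 2) - B₀ ≤ primeShiftForm b u := by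
    have e : 2 * (b + Real.sinh b) + (1 + 1 / 1) * (2 * I) - K - κ = farCoercivityFloor b - D := by rw [hκ]; ring
    rw [e]; linarith
  have hrig := integral_sq_sub_profile_le_of_RH hRH hb0 hu hus one_pos ht₀0 hSpos hB₀ hCint hA (κ := κ)
    (by rw [← hI, ← hK]; exact hnear')
  refine hrig.trans ?_
  -- `κ ≤ 2I + 2β + 1 + D` from `λ_max(b) ≥ R_c(b) ≥ e^b + 2b − 2 − 2γ − β − 1`
  have hR := (abs_le.1 (ha₁ b hb1)).1
  have hRc : (∑ n ∈ Finset.Ioc 0 ⌊Real.exp (2 * b)⌋₊,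
      (Λ n : ℝ) * (Real.exp b / n - Real.exp (-b) + (2 * b - Real.log n) * (1 + 1 / n) / 2)) / (b + Real.sinh b)
        ≤ farCoercivityFloor b := coshSum_div_le_farCoercivityFloor hb0
  have hκle : κ ≤ 2 * I + 2 * nicolasBeta + 1 + D := by
    have hβ : nicolasBeta = 2 + Real.eulerMascheroniConstant - Real.log (4 * π) := by
      unfold nicolasBeta
      rw [Real.log_mul (by norm_num) Real.pi_pos.ne', show (4 : ℝ) = 2 ^ 2 by norm_num, Real.log_pow]
      push_cast; ring
    have h2P : 2 * (b + Real.sinh b) = 2 * b + Real.exp b - Real.exp (-b) := by rw [Real.sinh_eq]; ring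
    rw [hκ, hK, h2P]
    nlinarith [hR, hRc, Real.exp_pos (-b), hβ]
  -- compare the two fractions: numerators, then denominators (`P ≤ S`)
  have hM0 : 0 ≤ (2 * I + 2 * nicolasBeta + 1 + D) * (∫ x, u x ^ 2) + 2 * B₀ := by
    have hβ0 : 0 ≤ nicolasBeta := by
      have := (abs_nonneg _).trans (abs_zeroSum_div_le_of_RH hRH (by linarith : (1 : ℝ) ≤ b)); exact this
    positivity
  have hnum : κ * (∫ x, u x ^ 2) + 2 * B₀ ≤ (2 * I + 2 * nicolasBeta + 1 + D) * (∫ x, u x ^ 2) + 2 * B₀ := by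
    have := mul_le_mul_of_nonneg_right hκle hNu0; linarith
  calc (κ * (∫ x, u x ^ 2) + 2 * B₀) / (2 * (b + Real.sinh b) + (1 + 1 / 1) * (2 * I) - 4 * (1 + 1) * weilArchTail t₀)
      ≤ ((2 * I + 2 * nicolasBeta + 1 + D) * (∫ x, u x ^ 2) + 2 * B₀)
          / (2 * (b + Real.sinh b) + (1 + 1 / 1) * (2 * I) - 4 * (1 + 1) * weilArchTail t₀) :=
        div_le_div_of_nonneg_right hnum hSpos.le
    _ ≤ ((2 * I + 2 * nicolasBeta + 1 + D) * (∫ x, u x ^ 2) + 2 * B₀) / (b + Real.sinh b) :=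
        div_le_div_of_nonneg_left hM0 hP0' (by rw [← hP]; exact hS)

/-! ## §2 The orthogonal complement of the cosh profile carries only `O(log(1/t₀))` of the form -/

/-- **UNDER RH, OFF THE COSH PROFILE THE PRIME-SHIFT FORM IS LOGARITHMIC.**  For `b ≥ 4`, a real Weil test `u` on `[−b, b]` ORTHOGONAL to
`C_b = cosh(·/2)·1_{[−b,b]}`, and a small-scale budget `∫_{(0,t₀]} ρ_∞ D_t(u) ≤ B₀` (`0 < t₀ ≤ 1`):
`Q_b(u) ≤ (8Ψ(t₀) − (2I₀ + log 4π + γ))·∫u² + B₀ ≤ (4 log(1/t₀) + 16)·∫u² + B₀` — while `Q_b(C_b) ≍ e^b‖C_b‖²`: the whole exponential size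
of the floor lives in ONE direction (the split `primeShiftForm_add_le_of_RH_split` with `m = ⟨u,C_b⟩²/‖C_b‖² = 0`; gen10 measured the second
Galerkin eigenvalue `λ₂(h) ≈ 0.8·log(1/h)`, FORMAT-K3 §11.15). -/
theorem primeShiftForm_le_of_RH_of_orthogonal (hRH : RiemannHypothesis) {b : ℝ} (hb : 4 ≤ b) {u : ℝ → ℝ}
    (hu : IsWeilTest fun x ↦ (u x : ℂ)) (hus : tsupport (fun x ↦ (u x : ℂ)) ⊆ Icc (-b) b)
    (horth : ∫ x, u x * (Icc (-b) b).indicator (fun y ↦ Real.cosh (y / 2)) x = 0)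
    {t₀ B₀ : ℝ} (ht₀ : 0 < t₀) (ht₀1 : t₀ ≤ 1)
    (hB₀ : ∫ t in Ioc 0 t₀, weilArchDensity t * ∫ x, (u (x + t) - u x) ^ 2 ≤ B₀) :
    primeShiftForm b u
        ≤ (8 * weilArchTail t₀ - (2 * (∫ t in Ioi (0 : ℝ), (Real.exp (t / 2) - 1) / (2 * Real.sinh t))
            + (Real.log (4 * π) + Real.eulerMascheroniConstant))) * (∫ x, u x ^ 2) + B₀ ∧
      primeShiftForm b u ≤ (4 * Real.log (1 / t₀) + 16) * (∫ x, u x ^ 2) + B₀ := by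
  have hb0 : 0 < b := by linarith
  obtain ⟨hCint, hA⟩ := coshProfile_archEnergy_le hb ht₀ ht₀1
  have h := primeShiftForm_add_le_of_RH_split hRH hb0 hu hus one_pos ht₀ hB₀ hCint hA
  rw [horth] at h
  simp only [zero_pow two_ne_zero, zero_div, mul_zero, zero_add, sub_zero] at h
  have hK := killingConstant_nonneg
  have hΨ := weilArchTail_le_half_log ht₀ ht₀1
  have hN : 0 ≤ ∫ x, u x ^ 2 := integral_nonneg fun x ↦ sq_nonneg _
  constructor
  · norm_num at h; linarith
  · norm_num at h
    have := mul_le_mul_of_nonneg_right hΨ hN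
    nlinarith [this, hK, hN]

end FloorCoshSplit

end Summit.RiemannHypothesis.RiemannHypothesis.Theorems.WeilFormatC
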